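import Summits.Ventures.HodgeRepro2.T5SU11PhaseLaw
import Summits.Ventures.HodgeRepro2.T5BergmanParseval

/-!
# The law of the phase without integrability hypotheses (Tonelli form), and ALL the moments

`T5SU11PhaseLaw` proved `∫_G F(log|a(g)|) dν = 2π ∫_0^∞ F(s) e^{2s} ds` assuming the left side integrable.
Here the same identity is proved for LEBESGUE integrals of non-negative functions, with no
integrability hypothesis at all, by a second route — the fibration `ν = Φ_*(poincare ⊗ μ_K)`
(`lintegral_nu_eq`, the `lintegral` form of `T5SU11FibrationHaar.integral_eq`), the disc in polar
coordinates (`T5BergmanParseval.lintegral_ball_eq_polar`), and the radial substitution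
`s = −½ log(1 − r²)`, `r ∈ (0, 1) ↦ s ∈ (0, ∞)`, `r (1 − r²)^{−2} dr = e^{2s} ds`:

  **`∫⁻_G F(log|a(g)|) dν = 2π · ∫⁻_0^∞ F(s) e^{2s} ds`**   (`lintegral_phase_eq`).

Consequences: `F ∘ log|a| ∈ L¹(ν)` **iff** `F(s) e^{2s} ∈ L¹(0, ∞)` (`integrable_phase_iff`), the Bochner
identity with the one-sided hypothesis (`integral_phase_eq'`), and **every moment of the phase** under
`(1 − |g·0|²)^{k/2} dν`: `∫_G (log|a(g)|)ⁿ (1 − |g·0|²)^{k/2} dν = 2π · n!/(k − 2)^{n+1}` for `k > 2`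
(`integral_log_pow_mul_orbit_rpow`; Mathlib's `Real.integral_rpow_mul_exp_neg_mul_Ioi` — Euler's
integral) — the phase is exactly exponentially distributed with rate `k − 2`, as `T5SU11JacobiPhaseMoments`
found for `n ≤ 2` by differentiation. Nothing is claimed about (N).

Blind lane: Mathlib + the HodgeRepro2 prefix only; no sorry; axioms ⊆ {propext, Classical.choice,
Quot.sound}.
-/

namespace Summit.Ventures.HodgeRepro2.T5SU11PhaseLawLintegral

open MeasureTheory MeasureTheory.Measure Metric Set Filter Topology
open T5PoincareMeasure T5SU11Unimodular T5SU11Fibration T5SU11Cartan T5SU11CartanProjection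
  T5SU11FibrationCartan T5HaarCircle T5BergmanCoefficient T5BergmanParseval T5SU11FibrationHaar T5SU11SphericalFunction
  T5SU11SphericalSymmetry T5SU11JacobiIwasawa T5SU11JacobiTransform T5SU11JacobiWeight
  T5SU11PhaseLaw
open scoped Real ENNReal

/-! ### The radial substitution `s = −½ log(1 − r²)` -/

/-- `r ↦ −½ log(1 − r²)` maps `(0, 1)` onto `(0, ∞)`. -/
lemma image_radial_Ioo :
    (fun r : ℝ => -(1 / 2) * Real.log (1 - r ^ 2)) '' Ioo 0 1 = Ioi 0 := by
  ext s
  constructor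
  · rintro ⟨r, ⟨hr0, hr1⟩, rfl⟩
    rw [mem_Ioi]
    have h1 : 1 - r ^ 2 < 1 := by nlinarith
    have h0 : 0 < 1 - r ^ 2 := by nlinarith
    have := Real.log_neg h0 h1
    linarith
  · intro hs
    rw [mem_Ioi] at hs
    have he : 0 < Real.exp (-(2 * s)) := Real.exp_pos _
    have he1 : Real.exp (-(2 * s)) < 1 := by
      rw [Real.exp_lt_one_iff]
      linarith
    refine ⟨Real.sqrt (1 - Real.exp (-(2 * s))), ⟨Real.sqrt_pos.mpr (by linarith), ?_⟩, ?_⟩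
    · rw [Real.sqrt_lt' one_pos, one_pow]
      linarith
    · show -(1 / 2) * Real.log (1 - Real.sqrt (1 - Real.exp (-(2 * s))) ^ 2) = s
      rw [Real.sq_sqrt (by linarith), sub_sub_cancel, Real.log_exp]
      ring

/-- `r ↦ −½ log(1 − r²)` is strictly increasing, hence injective, on `(0, 1)`. -/
lemma injOn_radial_Ioo : InjOn (fun r : ℝ => -(1 / 2) * Real.log (1 - r ^ 2)) (Ioo 0 1) := by
  refine StrictMonoOn.injOn fun r₁ hr₁ r₂ hr₂ h => ?_
  show -(1 / 2) * Real.log (1 - r₁ ^ 2) < -(1 / 2) * Real.log (1 - r₂ ^ 2)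
  have h1 : 0 < 1 - r₂ ^ 2 := by nlinarith [hr₂.1, hr₂.2]
  have h2 : 1 - r₂ ^ 2 < 1 - r₁ ^ 2 := by nlinarith [hr₁.1, hr₂.1]
  have := Real.log_lt_log h1 h2
  linarith

/-- `(−½ log(1 − r²))' = r/(1 − r²)` on `(0, 1)`. -/
lemma hasDerivWithinAt_radial {r : ℝ} (hr : r ∈ Ioo (0 : ℝ) 1) :
    HasDerivWithinAt (fun r : ℝ => -(1 / 2) * Real.log (1 - r ^ 2)) (r / (1 - r ^ 2)) (Ioo 0 1) r := by
  have h0 : 1 - r ^ 2 ≠ 0 := by nlinarith [hr.1, hr.2]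
  have h : HasDerivAt (fun r : ℝ => 1 - r ^ 2) (-(2 * r)) r := by
    have := ((hasDerivAt_id r).pow 2).const_sub 1
    refine this.congr_deriv ?_
    simp
  have h2 := (h.log h0).const_mul (-(1 / 2 : ℝ))
  refine h2.hasDerivWithinAt.congr_deriv ?_
  field_simp

/-- **The radial substitution**: for `G ≥ 0` on `(0, ∞)`,
`∫⁻_{s>0} G(s) = ∫⁻_{r∈(0,1)} (r/(1 − r²)) · G(−½ log(1 − r²))`. -/
theorem lintegral_Ioi_comp_radial (G : ℝ → ℝ≥0∞) :
    ∫⁻ s in Ioi (0 : ℝ), G s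
      = ∫⁻ r in Ioo (0 : ℝ) 1, ENNReal.ofReal (|r / (1 - r ^ 2)|) * G (-(1 / 2) * Real.log (1 - r ^ 2)) := by
  have key := lintegral_image_eq_lintegral_abs_deriv_mul (s := Ioo 0 1)
    (f := fun r : ℝ => -(1 / 2) * Real.log (1 - r ^ 2)) (f' := fun r => r / (1 - r ^ 2))
    measurableSet_Ioo (fun r hr => hasDerivWithinAt_radial hr) injOn_radial_Ioo G
  rwa [image_radial_Ioo] at key

section measure

variable [MeasurableSpace Circle] [BorelSpace Circle]

/-! ### The fibration formula for Lebesgue integrals -/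

/-- **`∫⁻_G h dν = ∫⁻_𝔻 dens(z) · ∫⁻_K h(s(z) k) dk dA(z)`** for measurable `h : G → [0, ∞]`
(the `lintegral` form of `T5SU11FibrationHaar.integral_eq`). -/
theorem lintegral_nu_eq (h : SU11 → ℝ≥0∞) (hh : Measurable h) :
    ∫⁻ g, h g ∂(nu haarCircle)
      = ∫⁻ z in ball (0 : ℂ) 1, ENNReal.ofReal (dens z) * ∫⁻ u, h (sec z * rot u) ∂haarCircle := by
  have hind : Measurable fun p : ℂ × Circle => h (fib p) := hh.comp measurable_fib
  rw [show nu haarCircle = map fib (poincare.prod haarCircle) from rfl, lintegral_map hh measurable_fib,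
    lintegral_prod _ hind.aemeasurable]
  unfold poincare
  rw [lintegral_withDensity_eq_lintegral_mul _ measurable_dens.ennreal_ofReal
    (Measurable.lintegral_prod_right' hind)]
  rfl

/-- For a right-`K`-invariant `h`, `∫⁻_G h dν = ∫⁻_𝔻 dens(z) · h(s(z)) dA(z)`. -/
theorem lintegral_nu_of_right_rot_invariant (h : SU11 → ℝ≥0∞) (hh : Measurable h)
    (hK : ∀ (g : SU11) (u : Circle), h (g * rot u) = h g) :
    ∫⁻ g, h g ∂(nu haarCircle) = ∫⁻ z in ball (0 : ℂ) 1, ENNReal.ofReal (dens z) * h (sec z) := by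
  rw [lintegral_nu_eq h hh]
  refine setLIntegral_congr_fun measurableSet_ball fun z _ => ?_
  simp only [hK, lintegral_const, haarCircle_univ, mul_one]

/-! ### The phase on the disc -/

omit [MeasurableSpace Circle] [BorelSpace Circle] in
/-- `log|a(s(z))| = −½ log(1 − |z|²)` for `z ∈ 𝔻`. -/
lemma log_norm_mat_sec {z : ℂ} (hz : z ∈ ball (0 : ℂ) 1) :
    Real.log ‖mat (sec z) 0 0‖ = -(1 / 2) * Real.log (1 - ‖z‖ ^ 2) := by
  have h := one_sub_norm_orbit_sq (sec z)
  rw [orbit_sec hz] at h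
  rw [h, inv_pow, Real.log_inv, Real.log_pow]
  push_cast
  ring

omit [MeasurableSpace Circle] [BorelSpace Circle] in
/-- The phase is right-`K`-invariant: `log|a(g k)| = log|a(g)|`. -/
lemma log_norm_mat_mul_rot (g : SU11) (u : Circle) :
    Real.log ‖mat (g * rot u) 0 0‖ = Real.log ‖mat g 0 0‖ := by
  rw [← cosh_cartanT (g * rot u), ← cosh_cartanT g]
  congr 2
  have := cartanT_rot_mul_rot 1 u g
  rwa [map_one, one_mul] at this

/-! ### The law of the phase, Tonelli form -/

/-- **THE LAW OF THE PHASE (Lebesgue-integral form)**: for every continuous `F`,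
`∫⁻_G F(log|a(g)|)⁺ dν = 2π · ∫⁻_0^∞ (F(s) e^{2s})⁺ ds` (`ENNReal.ofReal` on both sides) — no
integrability hypothesis. -/
theorem lintegral_phase_eq {F : ℝ → ℝ} (hF : Continuous F) :
    ∫⁻ g, ENNReal.ofReal (F (Real.log ‖mat g 0 0‖)) ∂(nu haarCircle)
      = ENNReal.ofReal (2 * π) * ∫⁻ s in Ioi (0 : ℝ), ENNReal.ofReal (F s * Real.exp (2 * s)) := by
  have hcont : Continuous fun g : SU11 => F (Real.log ‖mat g 0 0‖) :=
    hF.comp T5SU11JacobiWeightDeriv.continuous_log_norm_mat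
  rw [lintegral_nu_of_right_rot_invariant _ hcont.measurable.ennreal_ofReal
    (fun g u => by rw [log_norm_mat_mul_rot])]
  -- the disc integral of `dens(z) F(−½ log(1 − |z|²))`
  have e1 : ∫⁻ z in ball (0 : ℂ) 1, ENNReal.ofReal (dens z) * ENNReal.ofReal (F (Real.log ‖mat (sec z) 0 0‖))
      = ∫⁻ z in ball (0 : ℂ) 1, ENNReal.ofReal (dens z * F (-(1 / 2) * Real.log (1 - ‖z‖ ^ 2))) := by
    refine setLIntegral_congr_fun measurableSet_ball fun z hz => ?_
    rw [log_norm_mat_sec hz, ENNReal.ofReal_mul (dens_nonneg z)]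
  rw [e1]
  have hcontD : ContinuousOn (fun z : ℂ => dens z * F (-(1 / 2) * Real.log (1 - ‖z‖ ^ 2))) (ball 0 1) := by
    have h1 : ContinuousOn (fun z : ℂ => 1 - ‖z‖ ^ 2) (ball 0 1) :=
      (continuous_const.sub (continuous_norm.pow 2)).continuousOn
    have hpos : ∀ z ∈ ball (0 : ℂ) 1, 1 - ‖z‖ ^ 2 ≠ 0 := fun z hz => by
      rw [mem_ball_zero_iff] at hz
      nlinarith [norm_nonneg z]
    have hd : ContinuousOn dens (ball 0 1) := by
      refine ContinuousOn.congr ?_ fun z _ => dens_eq_norm z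
      exact (continuousOn_const.div (h1.pow 2) fun z hz => pow_ne_zero 2 (hpos z hz))
    exact hd.mul (hF.comp_continuousOn ((h1.log hpos).const_smul (-(1 / 2 : ℝ))))
  rw [lintegral_ball_eq_polar _ hcontD]
  -- the inner integral is constant in `θ`
  have e2 : ∀ r ∈ Ioo (0 : ℝ) 1,
      ∫⁻ θ in Ioo (-π) π, ENNReal.ofReal (r * (dens (circleMap 0 r θ)
        * F (-(1 / 2) * Real.log (1 - ‖circleMap 0 r θ‖ ^ 2))))
      = ENNReal.ofReal (2 * π) * ENNReal.ofReal (r / (1 - r ^ 2) ^ 2 * F (-(1 / 2) * Real.log (1 - r ^ 2))) := by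
    intro r hr
    have hn : ∀ θ, ‖circleMap 0 r θ‖ = r := fun θ => by
      rw [norm_circleMap_zero, abs_of_pos hr.1]
    have e : ∀ θ, r * (dens (circleMap 0 r θ) * F (-(1 / 2) * Real.log (1 - ‖circleMap 0 r θ‖ ^ 2)))
        = r / (1 - r ^ 2) ^ 2 * F (-(1 / 2) * Real.log (1 - r ^ 2)) := fun θ => by
      rw [dens_eq_norm, hn]
      ring
    simp_rw [e]
    rw [lintegral_const, Measure.restrict_apply MeasurableSet.univ, univ_inter, Real.volume_Ioo,
      mul_comm]
    congr 2
    ring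
  rw [setLIntegral_congr_fun measurableSet_Ioo e2, lintegral_const_mul _ (by fun_prop)]
  congr 1
  rw [lintegral_Ioi_comp_radial (fun s => ENNReal.ofReal (F s * Real.exp (2 * s)))]
  refine setLIntegral_congr_fun measurableSet_Ioo fun r hr => ?_
  have h0 : 0 < 1 - r ^ 2 := by nlinarith [hr.1, hr.2]
  have hd : 0 < r / (1 - r ^ 2) := div_pos hr.1 h0
  rw [abs_of_pos hd, ← ENNReal.ofReal_mul hd.le]
  congr 1
  have e3 : Real.exp (2 * (-(1 / 2) * Real.log (1 - r ^ 2))) = (1 - r ^ 2)⁻¹ := by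
    rw [show 2 * (-(1 / 2) * Real.log (1 - r ^ 2)) = -Real.log (1 - r ^ 2) by ring, Real.exp_neg,
      Real.exp_log h0]
  rw [e3]
  field_simp

/-! ### Consequences -/

/-- **Integrability criterion**: `F ∘ log|a| ∈ L¹(ν)` iff `F(s) e^{2s} ∈ L¹(0, ∞)`, for continuous
`F ≥ 0` on `[0, ∞)`. -/
theorem integrable_phase_iff {F : ℝ → ℝ} (hF : Continuous F) (hF0 : ∀ s, 0 ≤ s → 0 ≤ F s) :
    Integrable (fun g => F (Real.log ‖mat g 0 0‖)) (nu haarCircle)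
      ↔ IntegrableOn (fun s => F s * Real.exp (2 * s)) (Ioi 0) := by
  have hcont : Continuous fun g : SU11 => F (Real.log ‖mat g 0 0‖) :=
    hF.comp T5SU11JacobiWeightDeriv.continuous_log_norm_mat
  have hR : Continuous fun s => F s * Real.exp (2 * s) :=
    hF.mul (Real.continuous_exp.comp (continuous_const.mul continuous_id))
  have hL0 : 0 ≤ᵐ[nu haarCircle] fun g => F (Real.log ‖mat g 0 0‖) :=
    ae_of_all _ fun g => hF0 _ (log_norm_mat_nonneg g)
  have hR0 : 0 ≤ᵐ[volume.restrict (Ioi (0 : ℝ))] fun s => F s * Real.exp (2 * s) :=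
    (ae_restrict_iff' measurableSet_Ioi).mpr (ae_of_all _ fun s hs =>
      mul_nonneg (hF0 s (le_of_lt hs)) (Real.exp_pos _).le)
  rw [Integrable, IntegrableOn, Integrable, hasFiniteIntegral_iff_ofReal hL0,
    hasFiniteIntegral_iff_ofReal hR0, lintegral_phase_eq hF]
  have h2π : ENNReal.ofReal (2 * π) ≠ 0 := by
    rw [Ne, ENNReal.ofReal_eq_zero, not_le]
    positivity
  have h2π' : ENNReal.ofReal (2 * π) ≠ ∞ := ENNReal.ofReal_ne_top
  constructor
  · rintro ⟨_, h⟩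
    exact ⟨hR.aestronglyMeasurable, (ENNReal.mul_lt_top_iff.mp h).elim (fun h' => h'.2)
      (fun h' => h'.elim (fun h0 => absurd h0 h2π) fun h0 => by rw [h0]; exact ENNReal.zero_lt_top)⟩
  · rintro ⟨_, h⟩
    exact ⟨hcont.aestronglyMeasurable, ENNReal.mul_lt_top h2π'.lt_top h⟩

/-- **The law of the phase with the one-sided hypothesis**: for continuous `F ≥ 0` on `[0, ∞)` with
`F(s) e^{2s} ∈ L¹(0, ∞)`, `∫_G F(log|a(g)|) dν = 2π ∫_0^∞ F(s) e^{2s} ds`. -/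
theorem integral_phase_eq' {F : ℝ → ℝ} (hF : Continuous F) (hF0 : ∀ s, 0 ≤ s → 0 ≤ F s)
    (hR : IntegrableOn (fun s => F s * Real.exp (2 * s)) (Ioi 0)) :
    ∫ g, F (Real.log ‖mat g 0 0‖) ∂(nu haarCircle)
      = 2 * π * ∫ s in Ioi (0 : ℝ), F s * Real.exp (2 * s) :=
  integral_phase_eq hF hF0 ((integrable_phase_iff hF hF0).mpr hR)

omit [MeasurableSpace Circle] [BorelSpace Circle] in
/-- Euler's integral: `∫_0^∞ sⁿ e^{−rs} ds = n!/r^{n+1}` for `r > 0`. -/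
lemma integral_pow_mul_exp_neg_mul_Ioi (n : ℕ) {r : ℝ} (hr : 0 < r) :
    ∫ s in Ioi (0 : ℝ), s ^ n * Real.exp (-(r * s)) = (n.factorial : ℝ) / r ^ (n + 1) := by
  have h := Real.integral_rpow_mul_exp_neg_mul_Ioi (a := (n : ℝ) + 1) (r := r) (by positivity) hr
  rw [add_sub_cancel_right, Real.Gamma_nat_eq_factorial, show (n : ℝ) + 1 = ((n + 1 : ℕ) : ℝ) by
    push_cast; ring, Real.rpow_natCast] at h
  have e : (fun t : ℝ => t ^ ((n : ℝ)) * Real.exp (-(r * t))) = fun t => t ^ n * Real.exp (-(r * t)) := by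
    funext t
    rw [Real.rpow_natCast]
  rw [e] at h
  rw [h, one_div, inv_pow, div_eq_mul_inv, mul_comm]

omit [MeasurableSpace Circle] [BorelSpace Circle] in
/-- `sⁿ e^{−ks} e^{2s}` is integrable on `(0, ∞)` for `k > 2` (Euler's integral, scaled). -/
lemma integrableOn_pow_mul_exp_neg (n : ℕ) {k : ℝ} (hk : 2 < k) :
    IntegrableOn (fun s : ℝ => s ^ n * Real.exp (-(k * s)) * Real.exp (2 * s)) (Ioi 0) := by
  have hk2 : 0 < k - 2 := by linarith
  have h := Real.GammaIntegral_convergent (s := (n : ℝ) + 1) (by positivity)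
  rw [add_sub_cancel_right] at h
  have h2 := (integrableOn_Ioi_comp_mul_left_iff (fun x : ℝ => Real.exp (-x) * x ^ (n : ℝ)) 0 hk2).mpr
    (by rwa [mul_zero])
  have h3 := h2.const_mul (((k - 2) ^ n)⁻¹)
  refine IntegrableOn.congr_fun h3 (fun s hs => ?_) measurableSet_Ioi
  rw [mem_Ioi] at hs
  show ((k - 2) ^ n)⁻¹ * (Real.exp (-((k - 2) * s)) * ((k - 2) * s) ^ (n : ℝ))
    = s ^ n * Real.exp (-(k * s)) * Real.exp (2 * s)
  rw [Real.rpow_natCast, mul_pow, mul_assoc (s ^ n), ← Real.exp_add,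
    show -(k * s) + 2 * s = -((k - 2) * s) by ring]
  have hne : (k - 2) ^ n ≠ 0 := pow_ne_zero n hk2.ne'
  field_simp

/-- **Every moment of the phase**: `∫_G (log|a(g)|)ⁿ (1 − |g·0|²)^{k/2} dν = 2π · n!/(k − 2)^{n+1}` for
`k > 2` — the moments of the exponential law of rate `k − 2`. -/
theorem integral_log_pow_mul_orbit_rpow (n : ℕ) {k : ℝ} (hk : 2 < k) :
    ∫ g, Real.log ‖mat g 0 0‖ ^ n * (1 - ‖orbit g‖ ^ 2) ^ (k / 2) ∂(nu haarCircle)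
      = 2 * π * ((n.factorial : ℝ) / (k - 2) ^ (n + 1)) := by
  have hF : Continuous fun s : ℝ => s ^ n * Real.exp (-(k * s)) := by fun_prop
  have hF0 : ∀ s, 0 ≤ s → 0 ≤ s ^ n * Real.exp (-(k * s)) := fun s hs =>
    mul_nonneg (pow_nonneg hs n) (Real.exp_pos _).le
  simp_rw [orbit_rpow_eq_exp]
  rw [integral_phase_eq' (F := fun s => s ^ n * Real.exp (-(k * s))) hF hF0
    (integrableOn_pow_mul_exp_neg n hk)]
  congr 1
  have e2 : ∀ s : ℝ, s ^ n * Real.exp (-(k * s)) * Real.exp (2 * s)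
      = s ^ n * Real.exp (-((k - 2) * s)) := fun s => by
    rw [mul_assoc, ← Real.exp_add]
    congr 2
    ring
  simp_rw [e2]
  exact integral_pow_mul_exp_neg_mul_Ioi n (by linarith)

/-- The normalised `n`-th moment: `⟨(log|a|)ⁿ⟩_{k,0} = n!/(k − 2)ⁿ`. -/
theorem moment_phase (n : ℕ) {k : ℝ} (hk : 2 < k) :
    (∫ g, Real.log ‖mat g 0 0‖ ^ n * (1 - ‖orbit g‖ ^ 2) ^ (k / 2) ∂(nu haarCircle))
        / ∫ g, (1 - ‖orbit g‖ ^ 2) ^ (k / 2) ∂(nu haarCircle) = (n.factorial : ℝ) / (k - 2) ^ n := by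
  rw [integral_log_pow_mul_orbit_rpow n hk, integral_orbit_rpow_nu hk]
  have hk2 : k - 2 ≠ 0 := by
    intro h
    linarith
  field_simp
  ring

end measure

end Summit.Ventures.HodgeRepro2.T5SU11PhaseLawLintegral
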